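import Summits.RiemannHypothesis.RiemannHypothesis.Theorems.WeilFormatCTailMSBridge
import Summits.RiemannHypothesis.RiemannHypothesis.Theorems.WeilFormatCMiddleEvenJ
import Summits.RiemannHypothesis.RiemannHypothesis.Theorems.WeilFormatCMiddleOddJ
import Summits.RiemannHypothesis.RiemannHypothesis.Theorems.WeilFormatCDataRungPieces
import Literature.NumberTheory.LFunctions.YoshidaWindowGramMiddleJ
import Literature.NumberTheory.LFunctions.YoshidaWindowGramTailMSFactored
import HarnessLib

/-!
# Format C: the COMPRESSED MIDDLE inside the column-band kit — «MJ + MS» through the `_kernelsA` door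

Helper file of the rh-explicit Weil-positivity programme (`--supports stmt-RiemannHypothesis-0098`; seat
rh-explicit-weil-2 gen7), RH-free, no definitions, no named facts.

The column-band kit `WeilFormatC.weilPositivityOn_of_kitCB` (door `weilPositivityOn_of_formatC_kernelsA`) takes, per
sector, ANY matrix `U₂` majorising `Σ_{m ≥ B₃} (b_m·x)²/d_m` for every `d` above the certified floor `d₀ ≤ d̂(B₃)`,
together with a factorisation `U₂ = Σ_r φ_r ψ_rᵀ + diag`.  weil-10's compressed exact middle
(`even/odd_middleJ_majorant_matrix`, design MJ) bounds the slice `[B₃, B₄)` with per-mode weights `0 < w ≤ d`; with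
the CONSTANT-in-`d` weights `w ≤ d₀` it needs nothing beyond the door's floor, so

  `U₂ := U_mid(w) + U₂^{MS}(from B₄)`   (`U2EvenMidMS_majorant` / `U2OddMidMS_majorant`)

is an admissible kit tail whose exact columns stop at `B₃` while the analytic (mean-square, part VIII) tail only starts
at `B₄ ≥ B₃` — the long exact-column range `[B₃, B₄)` of a plain MS rung is replaced by `(2J)²+1` finite moments of the
light table (part XI-b).  Both pieces share the order-`J` left factors, so the sum is again ONE factored form with
`2J` factors (`U2EvenMidMS_eq_factoredS` / odd): `ψ = ψ_mid·B^p + ψ_MS·B^p`, `diag = d_mid + dg`.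

* `even_middle_majorant_Umid`, `odd_middle_majorant_Umid` — weil-10's theorems restated on `Encl.UmidEvenJ/UmidOddJ`;
* `U2EvenMidMS_majorant`, `U2OddMidMS_majorant` — the kit's `hU2E`/`hU2O` premise for the combined tail;
* `U2EvenMidMS_eq_factoredS`, `U2OddMidMS_eq_factoredS`, `U2EvenMidMS_comm`, `U2OddMidMS_comm`.
-/

set_option linter.dupNamespace false
set_option autoImplicit false

noncomputable section

open Complex Finset Matrix
open scoped Real BigOperators ArithmeticFunction.vonMangoldt

namespace Summit.RiemannHypothesis.RiemannHypothesis.Theorems.WeilFormatC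

open Literature.NumberTheory.LFunctions Literature.NumberTheory.LFunctions.Yoshida1992
  Literature.NumberTheory.LFunctions.Yoshida1992.Encl

variable {a : ℝ}

/-- `Matrix.of (f + g) = Matrix.of f + Matrix.of g` as quadratic forms. -/
theorem dotProduct_of_add_mulVec {B : ℕ} (f g : Fin B → Fin B → ℝ) (x : Fin B → ℝ) :
    x ⬝ᵥ (Matrix.of fun i j ↦ f i j + g i j) *ᵥ x = x ⬝ᵥ (Matrix.of f) *ᵥ x + x ⬝ᵥ (Matrix.of g) *ᵥ x := by
  have : (Matrix.of fun i j ↦ f i j + g i j) = Matrix.of f + Matrix.of g := by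
    ext i j; simp only [Matrix.of_apply, Matrix.add_apply]
  rw [this, Matrix.add_mulVec, dotProduct_add]

/-! ## Even sector -/

/-- weil-10's even middle majorant on `Encl.UmidEvenJ`. -/
theorem even_middle_majorant_Umid (ha : 0 < a) {B B₃ B₄ : ℕ} (hB : 1 ≤ B) (hBB : 2 * B ≤ B₃) (J : ℕ)
    (d w : ℕ → ℝ) (hw : ∀ m, B₃ ≤ m → m < B₄ → 0 < w m ∧ w m ≤ d m) {θ : ℝ} (hθ : 0 < θ) (x : Fin B → ℝ) :
    ∑ m ∈ Finset.Ico B₃ B₄, (∑ i : Fin B,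
        (if (i : ℕ) = 0 then gramCoeff a 0 m else if m = 0 then gramCoeff a i 0
          else (gramCoeff a i m + gramCoeff a i (-(m : ℤ))) / 2) * x i) ^ 2 / d m
      ≤ x ⬝ᵥ (Matrix.of fun i i' : Fin B ↦ UmidEvenJ a θ B B₃ B₄ J w i i') *ᵥ x := by
  have h := even_middleJ_majorant_matrix ha hB hBB J d w hw hθ x
  refine h.trans (le_of_eq ?_)
  congr 2
  ext i i'
  simp only [Matrix.of_apply]
  exact UmidEvenJ_fin a θ B₃ B₄ J w i i'

/-- **The kit's even tail premise for `U_mid(w) + U₂^{MS}(B₄)`** under the door's single floor `d₀` (`w ≤ d₀` on the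
middle, mean-square tail from `B₄`). -/
theorem U2EvenMidMS_majorant (ha : 0 < a) {Be B3e B4e : ℕ} (hBe : 1 ≤ Be) (hBBe : 2 * Be ≤ B3e) (hB34 : B3e ≤ B4e)
    (Jm Je : ℕ) {θm θ η d0 : ℝ} (hθm : 0 < θm) (hθ : 0 < θ) (hη : 0 < η) (hd0 : 0 < d0)
    (w : ℕ → ℝ) (hw : ∀ m, B3e ≤ m → m < B4e → 0 < w m ∧ w m ≤ d0)
    (s₁ : ℕ → ℝ) (sm sp : ℕ → ℕ → ℝ)
    (hs₁ : ∀ k ∈ weilPrimeIndex a, IsPrimePow k → 0 ≤ s₁ k ∧ s₁ k ≤ |Real.sin (π * Real.log k / a / 2)|)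
    (hsm : ∀ k ∈ weilPrimeIndex a, ∀ k' ∈ weilPrimeIndex a, IsPrimePow k → IsPrimePow k' → k ≠ k' →
      0 ≤ sm k k' ∧ sm k k' ≤ |Real.sin ((π * Real.log k / a - π * Real.log k' / a) / 2)|)
    (hsp : ∀ k ∈ weilPrimeIndex a, ∀ k' ∈ weilPrimeIndex a, IsPrimePow k → IsPrimePow k' →
      0 ≤ sp k k' ∧ sp k k' ≤ |Real.sin ((π * Real.log k / a + π * Real.log k' / a) / 2)|)
    (d : ℕ → ℝ) (hd : ∀ m, B3e ≤ m → d0 ≤ d m) (N : ℕ) (x : Fin Be → ℝ) :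
    ∑ m ∈ Finset.Ico B3e N, (∑ i : Fin Be, (if (i : ℕ) = 0 then gramCoeff a 0 m else if m = 0 then gramCoeff a i 0
      else (gramCoeff a i m + gramCoeff a i (-(m : ℤ))) / 2) * x i) ^ 2 / d m
      ≤ x ⬝ᵥ (Matrix.of fun i j : Fin Be ↦ UmidEvenJ a θm Be B3e B4e Jm w i j
          + U2EvenJMS a θ η d0 Be B4e Je s₁ sm sp i j) *ᵥ x := by
  have hnn : ∀ m, B3e ≤ m → 0 ≤ (∑ i : Fin Be, (if (i : ℕ) = 0 then gramCoeff a 0 m else if m = 0 then gramCoeff a i 0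
      else (gramCoeff a i m + gramCoeff a i (-(m : ℤ))) / 2) * x i) ^ 2 / d m := fun m hm ↦
    div_nonneg (sq_nonneg _) (hd0.le.trans (hd m hm))
  have hmid := even_middle_majorant_Umid ha hBe hBBe Jm d w
    (fun m hm hm4 ↦ ⟨(hw m hm hm4).1, (hw m hm hm4).2.trans (hd m hm)⟩) hθm x
  have hB4 : 2 ≤ B4e := by omega
  have htail := U2EvenJMS_majorant ha hBe (B3e := B4e) (by omega) hB4 Je hθ hη hd0 s₁ sm sp hs₁ hsm hsp d
    (fun m hm ↦ hd m (by omega)) N x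
  rw [dotProduct_of_add_mulVec]
  exact (sum_Ico_le_sum_Ico_add_sum_Ico hB34 hnn).trans (add_le_add hmid htail)

/-- The combined even tail is ONE factored form over the order-`J` left factors (rescaled):
`ψ = ψ_mid·B^p + ψ_MS·B^p`, `diag = d_mid + dg`. -/
theorem U2EvenMidMS_eq_factoredS (a θm θ η d0 : ℝ) {Be : ℕ} (hBe : 0 < Be) (B3e B4e J : ℕ) (w : ℕ → ℝ)
    (s₁ : ℕ → ℝ) (sm sp : ℕ → ℕ → ℝ) (i i' : ℕ) :
    UmidEvenJ a θm Be B3e B4e J w i i' + U2EvenJMS a θ η d0 Be B4e J s₁ sm sp i i'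
      = (∑ r ∈ Finset.range (J + J), phiJeS a Be J i r *
          (psiMidES a θm Be B3e B4e J w i' r + psiMSeS a θ η d0 Be B4e J s₁ sm sp i' r))
        + (if i = i' then dMidE a θm Be B3e B4e J w i + dgJe a θ d0 Be B4e J i else 0) := by
  rw [UmidEvenJ_eq_factoredS a θm hBe, U2EvenJMS_eq_factoredS a θ η d0 hBe]
  rw [show ∀ (p q r s : ℝ), (p + q) + (r + s) = (p + r) + (q + s) from fun p q r s ↦ by ring, ← Finset.sum_add_distrib]
  congr 1
  · exact Finset.sum_congr rfl fun r _ ↦ by ring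
  · split_ifs <;> simp

/-- Symmetry of the combined even tail. -/
theorem U2EvenMidMS_comm (a θm θ η d0 : ℝ) (Be B3e B4e J : ℕ) (w : ℕ → ℝ) (s₁ : ℕ → ℝ) (sm sp : ℕ → ℕ → ℝ)
    (i i' : ℕ) :
    UmidEvenJ a θm Be B3e B4e J w i i' + U2EvenJMS a θ η d0 Be B4e J s₁ sm sp i i'
      = UmidEvenJ a θm Be B3e B4e J w i' i + U2EvenJMS a θ η d0 Be B4e J s₁ sm sp i' i := by
  rw [UmidEvenJ_comm, U2EvenJMS_comm]

/-! ## Odd sector -/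

/-- weil-10's odd middle majorant on `Encl.UmidOddJ`. -/
theorem odd_middle_majorant_Umid (ha : 0 < a) {B B₃ B₄ : ℕ} (hB : 1 ≤ B) (hBB : 2 * B ≤ B₃) (J : ℕ)
    (d w : ℕ → ℝ) (hw : ∀ l, B₃ ≤ l → l < B₄ → 0 < w l ∧ w l ≤ d l) {θ : ℝ} (hθ : 0 < θ) (x : Fin B → ℝ) :
    ∑ l ∈ Finset.Ico B₃ B₄, (∑ k : Fin B,
        ((gramCoeff a (((k : ℕ) : ℤ) + 1) ((l : ℤ) + 1) - gramCoeff a (((k : ℕ) : ℤ) + 1) (-((l : ℤ) + 1))) / 2) * x k) ^ 2 / d l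
      ≤ x ⬝ᵥ (Matrix.of fun k k' : Fin B ↦ UmidOddJ a θ B B₃ B₄ J w k k') *ᵥ x := by
  have h := odd_middleJ_majorant_matrix ha hB hBB J d w hw hθ x
  refine h.trans (le_of_eq ?_)
  congr 2
  ext k k'
  simp only [Matrix.of_apply]
  exact UmidOddJ_fin a θ B₃ B₄ J w k k'

/-- **The kit's odd tail premise for `U_mid(w) + U₂^{MS}(B₄)`** under the door's single floor `d₀`. -/
theorem U2OddMidMS_majorant (ha : 0 < a) {Bo B3o B4o : ℕ} (hBo : 1 ≤ Bo) (hBBo : 2 * Bo ≤ B3o) (hB34 : B3o ≤ B4o)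
    (Jm Jo : ℕ) {θm θ η d0 : ℝ} (hθm : 0 < θm) (hθ : 0 < θ) (hη : 0 < η) (hd0 : 0 < d0)
    (w : ℕ → ℝ) (hw : ∀ l, B3o ≤ l → l < B4o → 0 < w l ∧ w l ≤ d0)
    (s₁ : ℕ → ℝ) (sm sp : ℕ → ℕ → ℝ)
    (hs₁ : ∀ k ∈ weilPrimeIndex a, IsPrimePow k → 0 ≤ s₁ k ∧ s₁ k ≤ |Real.sin (π * Real.log k / a / 2)|)
    (hsm : ∀ k ∈ weilPrimeIndex a, ∀ k' ∈ weilPrimeIndex a, IsPrimePow k → IsPrimePow k' → k ≠ k' →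
      0 ≤ sm k k' ∧ sm k k' ≤ |Real.sin ((π * Real.log k / a - π * Real.log k' / a) / 2)|)
    (hsp : ∀ k ∈ weilPrimeIndex a, ∀ k' ∈ weilPrimeIndex a, IsPrimePow k → IsPrimePow k' →
      0 ≤ sp k k' ∧ sp k k' ≤ |Real.sin ((π * Real.log k / a + π * Real.log k' / a) / 2)|)
    (d : ℕ → ℝ) (hd : ∀ l, B3o ≤ l → d0 ≤ d l) (N : ℕ) (x : Fin Bo → ℝ) :
    ∑ l ∈ Finset.Ico B3o N, (∑ k : Fin Bo, ((gramCoeff a (((k : ℕ) : ℤ) + 1) ((l : ℤ) + 1)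
      - gramCoeff a (((k : ℕ) : ℤ) + 1) (-((l : ℤ) + 1))) / 2) * x k) ^ 2 / d l
      ≤ x ⬝ᵥ (Matrix.of fun k k' : Fin Bo ↦ UmidOddJ a θm Bo B3o B4o Jm w k k'
          + U2OddJMS a θ η d0 Bo B4o Jo s₁ sm sp k k') *ᵥ x := by
  have hnn : ∀ l, B3o ≤ l → 0 ≤ (∑ k : Fin Bo, ((gramCoeff a (((k : ℕ) : ℤ) + 1) ((l : ℤ) + 1)
      - gramCoeff a (((k : ℕ) : ℤ) + 1) (-((l : ℤ) + 1))) / 2) * x k) ^ 2 / d l := fun l hl ↦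
    div_nonneg (sq_nonneg _) (hd0.le.trans (hd l hl))
  have hmid := odd_middle_majorant_Umid ha hBo hBBo Jm d w
    (fun l hl hl4 ↦ ⟨(hw l hl hl4).1, (hw l hl hl4).2.trans (hd l hl)⟩) hθm x
  have htail := U2OddJMS_majorant ha hBo (B3o := B4o) (by omega) Jo hθ hη hd0 s₁ sm sp hs₁ hsm hsp d
    (fun l hl ↦ hd l (by omega)) N x
  rw [dotProduct_of_add_mulVec]
  exact (sum_Ico_le_sum_Ico_add_sum_Ico hB34 hnn).trans (add_le_add hmid htail)

/-- The combined odd tail is ONE factored form over the order-`J` left factors (rescaled). -/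
theorem U2OddMidMS_eq_factoredS (a θm θ η d0 : ℝ) {Bo : ℕ} (hBo : 0 < Bo) (B3o B4o J : ℕ) (w : ℕ → ℝ)
    (s₁ : ℕ → ℝ) (sm sp : ℕ → ℕ → ℝ) (k k' : ℕ) :
    UmidOddJ a θm Bo B3o B4o J w k k' + U2OddJMS a θ η d0 Bo B4o J s₁ sm sp k k'
      = (∑ r ∈ Finset.range (J + J), phiJoS a Bo J k r *
          (psiMidOS a θm Bo B3o B4o J w k' r + psiMSoS a θ η d0 Bo B4o J s₁ sm sp k' r))
        + (if k = k' then dMidO a θm Bo B3o B4o J w k + dgJo a θ d0 Bo B4o J k else 0) := by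
  rw [UmidOddJ_eq_factoredS a θm hBo, U2OddJMS_eq_factoredS a θ η d0 hBo]
  rw [show ∀ (p q r s : ℝ), (p + q) + (r + s) = (p + r) + (q + s) from fun p q r s ↦ by ring, ← Finset.sum_add_distrib]
  congr 1
  · exact Finset.sum_congr rfl fun r _ ↦ by ring
  · split_ifs <;> simp

/-- Symmetry of the combined odd tail. -/
theorem U2OddMidMS_comm (a θm θ η d0 : ℝ) (Bo B3o B4o J : ℕ) (w : ℕ → ℝ) (s₁ : ℕ → ℝ) (sm sp : ℕ → ℕ → ℝ)
    (k k' : ℕ) :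
    UmidOddJ a θm Bo B3o B4o J w k k' + U2OddJMS a θ η d0 Bo B4o J s₁ sm sp k k'
      = UmidOddJ a θm Bo B3o B4o J w k' k + U2OddJMS a θ η d0 Bo B4o J s₁ sm sp k' k := by
  rw [UmidOddJ_comm, U2OddJMS_comm]

end Summit.RiemannHypothesis.RiemannHypothesis.Theorems.WeilFormatC

end
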